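import Summits.QuantumFields.YangMills.Theorems.BalabanUVNodesN11TkIteratedFibreReading

/-!
# DAG node N11 — `𝐓_n(s)` OF RECORD AND THE §2 SLOT READ THEIR OPERAND ONLY ON THE ITERATED AVERAGING FIBRE, FOR a.e. TOP-SCALE FIELD (value-level faces of
# `…N11TkIteratedFibreReading`; the `RegOn` editions)

HEADER — WORK-UNIT METADATA.  Cell `pub-ymgap`, YM-PLAN Track A (HUMAN RULING D-0062), seat `pub-ymgap-dag-n11-d` (g13; R134 fan-out seat N11 [B14], strategy s2),
route `BalabanUVNodes`, item K1⁷ `StabilityBAtRecordR13SepCoPH` = stmt-QuantumFields-20542 (helper, `--kind proof --supports 20542 --as helper`, count-neutral).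
[III] = [Balaban1988Convergent], [B7] = [Balaban1985Averaging].  Over `…N11TkIteratedFibreReading` §4 (★★ `tkBranchOfRecord_congr_of_descending_fibre_ae`), p589098
`…N11TkReadingSupport` (whose pointwise `TkOfRecord_congr_on_read(_of_regOn)` ∕ `sect2Slot_congr_on_read(_of_regOn)` these theorems refine), 11a `Node00/TkOfRecord`, 11c
`sect2Slot`∕`sect2Operand`, 12a″ `Node00/TkWeightsOfRecordP` (`tkWeightsOfRecordP`, `RegOn`, `plaqSmallOn_readOn_of_zetaP_ne_zero`), g6 `measurePreserving_restrict_fieldMeasure`.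

WHAT THIS FILE PROVES (0 `sorry`, 0 `def`).
* ★★★ `TkOfRecord_congr_on_fibre_ae` — for `fieldMeasure`-a.e. top-scale field `V_n`: two operands of r11's shape agreeing at every `({S_i}, A, 𝐖)` with `𝐖 n = V_n`,
  `Reg j (𝐖 j)` (any property forced by a non-zero `ζ_j(Ω^c_{j+1}(s))`), `𝐖 j ≡ 1` off `bondsIn j (Ω_{j+1})ᶜ`, AND THE FIBRE IDENTITY `(avOfRecord j).avg (𝐖 j) b = 𝐖 (j+1) b` on
  `bondsIn (j+1) (Ω_{j+1})ᶜ`, all `j < n`, have the same `𝐓_n(s)`-image at `V_n` (the core theorem at the invariant «top = `V_n`; scales in `[i, n)` regular, trivial off their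
  V-bonds, on the fibre; scales `< i` trivial», pulled back along `V_n ↦ V_n|_{bondsIn n (Ω_n)ᶜ}`; `n = 0` pointwise).
* ★★★ `sect2Slot_congr_on_fibre_ae` — the §2 slot reads its operand only there (the shape `HasSect2FormAtZS`'s a.e. identity clause consumes).
* ★★★ `TkOfRecord_congr_on_fibre_ae_of_regOn` ∕ `sect2Slot_congr_on_fibre_ae_of_regOn` — at 12a″'s weights `tkWeightsOfRecordP … Z` under `Z.RegOn Γr`:
  `Reg j U := PlaqSmallOn (plaqsOf (pts j (Γr j (Ω_{j+1})ᶜ))) (cR·ε_j) U`.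
CONSEQUENCE (next files).  The (d4) chain's background proviso and junction need hold only on the iterated fibre, where the (7)-data row's mixed field IS `𝐖 (m+1)` on the
printed plaquettes — so its level-`(m+1)` clauses reduce to per-level regularities (reading regions for `m+1 < k`, `…N11ChiTopRegularity`'s top clause for `m+1 = k`).

HONEST FRAMING.  Helper lane of K1⁷; kernel bookkeeping of (2.18), (2.20)–(2.21); nothing of Bałaban's is asserted; 12a″'s `RegOn` is a HYPOTHESIS.  N11 NOT discharged;
K1⁷ NOT closed; counts unmoved (typed 28∕28 · discharged 5∕27).  One finite four-torus programme at fixed `ε = L^{−K}` — NOT ℝ⁴, NOT OS, NOT a mass gap, NOT Clay.  No `sorry`,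
`axiom`, `def`, `instance`, `notation`.  Sources (SHAPE only): [III] (2.10) p.256, (2.18) p.257, (2.20)–(2.23) p.258, (1.4) p.246, (1.11) p.248; [B7] (9)–(10) p.19.
-/

noncomputable section

open MeasureTheory
open scoped BigOperators ENNReal NNReal Matrix.Norms.L2Operator

namespace Summit.QuantumFields.YangMills.Theorems.BalabanUVNodesN11TkIteratedFibreReadingSlot

open Literature.MathematicalPhysics.QuantumFieldTheory.Balaban1983to89 T4Continuum Node00 Node00.Tk
open T4AdjointCovariance (JCfg insA)
open B15DeterminingSets B10Eq42TorusConstraint B8Eq17ClassAkV1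
open BalabanUVNodesN11TkReadingSupport (baseCfg_top_fst)
open BalabanUVNodesN11TkIteratedFibreReading (tkBranchOfRecord_congr_of_descending_fibre_ae baseCfg_fst_of_ne)

section Record

variable {F : T4Family} {N : ℕ} [NeZero N] {V : Type} [NormedAddCommGroup V] [InnerProductSpace ℝ V] [FiniteDimensional ℝ V] [MeasurableSpace V] [BorelSpace V]
variable (ν : Stage7Numerics) (M : ℕ) (g : ℕ → ℝ) (K : ℕ) (W : TkWeights F N V K)

/-! ## §1  `𝐓_n(s)` of record and the §2 slot read their operand only on the iterated fibre, for a.e. top-scale field -/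

/-- **★★★ `𝐓_n(s)` OF RECORD READS ITS OPERAND ONLY ON THE ITERATED AVERAGING FIBRE, FOR `fieldMeasure`-a.e. `V_n`** (r11's slot shape; p589098's
`TkOfRecord_congr_on_read` refined).  Let `Reg j` be any property of the scale-`j` gauge variables forced by a non-zero `ζ_j(Ω^c_{j+1}(s))` (`hζ`).  For almost every
top-scale field `V_n`: two operands agreeing at every `({S_i}, A, 𝐖)` with `𝐖 n = V_n`, `Reg j (𝐖 j)`, `𝐖 j ≡ 1` off `bondsIn j (Ω_{j+1})ᶜ` AND THE FIBRE IDENTITY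
`(avOfRecord j).avg (𝐖 j) b = 𝐖 (j+1) b` on `bondsIn (j+1) (Ω_{j+1})ᶜ`, for all `j < n`, have the same `𝐓_n(s)`-image at `V_n` (§4 at the descending invariant «top = `V_n`,
scales in `[i, n)` regular ∕ trivial off their V-bonds ∕ on the fibre, scales `< i` trivial», pulled back along `V_n ↦ V_n|_{bondsIn n (Ω_n)ᶜ}`).
[cite: Balaban1988Convergent, (2.18) p.257, (2.20)–(2.21) p.258, (2.10) p.256, (1.4) p.246; Balaban1985Averaging, (10) p.19] -/
theorem TkOfRecord_congr_on_fibre_ae {n : ℕ} (s : SeqOfRecord F ν M g K n) (Reg : (j : ℕ) → GaugeField (F.P K) j (SU N) → Prop)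
    (hζ : ∀ j, j < n → ∀ ω : MultiCfg (F.P K) (SU N) V, W.ζ j (s.Ω (j + 1))ᶜ ω ≠ 0 → Reg j (ω j).1) :
    ∀ᵐ Vn ∂fieldMeasure (F.P K) n (SU N), ∀ (Φ Φ' : SFluct (F.P K) V → MSField (F.P K) (SU N) → ℝ),
      (∀ (S : ℕ → Set (Site (F.P K) 0)) (a : MSFluct (F.P K) V) (U : MSField (F.P K) (SU N)), U n = Vn → (∀ j, j < n → Reg j (U j)) →
        (∀ j, j < n → ∀ b : PBond (F.P K) j, b ∉ bondsIn j (s.Ω (j + 1))ᶜ → U j b = 1) →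
        (∀ j, j < n → ∀ b : PBond (F.P K) (j + 1), b ∈ bondsIn (j + 1) (s.Ω (j + 1))ᶜ → (avOfRecord F N K j).avg (U j) b = U (j + 1) b) →
        Φ (S, a) U = Φ' (S, a) U) →
      TkOfRecord F N V ν M g K W n s Φ Vn = TkOfRecord F N V ν M g K W n s Φ' Vn := by
  cases n with
  | zero =>
    refine Filter.Eventually.of_forall fun V0 Φ Φ' hΦ => ?_
    rw [TkOfRecord_apply, TkOfRecord_apply]
    refine Finset.sum_congr rfl fun S _ => ?_
    rw [tkBranchOfRecord_zero, tkBranchOfRecord_zero]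
    exact hΦ S _ _ (baseCfg_top_fst K 0 V0) (fun j hj => absurd hj (Nat.not_lt_zero j)) (fun j hj => absurd hj (Nat.not_lt_zero j))
      (fun j hj => absurd hj (Nat.not_lt_zero j))
  | succ i =>
    have A := tkBranchOfRecord_congr_of_descending_fibre_ae ν M g K W s i
    have hpull := (measurePreserving_restrict_fieldMeasure (P := F.P K) (j := i + 1) (G := SU N)
      ((Set.toFinite (bondsIn (i + 1) (s.Ω (i + 1))ᶜ)).toFinset)).quasiMeasurePreserving.ae A
    filter_upwards [hpull] with Vn hVn Φ Φ' hΦ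
    rw [TkOfRecord_apply, TkOfRecord_apply]
    refine Finset.sum_congr rfl fun S _ => ?_
    refine hVn S
      (fun i' ω => i' ≤ i + 1 ∧ (ω (i + 1)).1 = Vn ∧ (∀ j, i' ≤ j → j < i + 1 → Reg j (ω j).1) ∧
        (∀ j, j < i' → ∀ b : PBond (F.P K) j, (ω j).1 b = 1) ∧
        (∀ j, i' ≤ j → j < i + 1 → ∀ b : PBond (F.P K) j, b ∉ bondsIn j (s.Ω (j + 1))ᶜ → (ω j).1 b = 1) ∧
        (∀ j, i' ≤ j → j < i + 1 → ∀ b : PBond (F.P K) (j + 1), b ∈ bondsIn (j + 1) (s.Ω (j + 1))ᶜ →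
          (avOfRecord F N K j).avg (ω j).1 b = (ω (j + 1)).1 b))
      ?_ _ _ ?_ (baseCfg (i + 1) Vn) ?_ ?_
    · -- the invariant descends through a charged scale-`i'` update agreeing off the V-bonds and satisfying the fibre identity
      rintro i' ω c₀ c' ⟨hi, htop, hreg, hlow, hoff, hfib⟩ hc hagree hfibre hz _
      have hin : i' < i + 1 := hi
      have hne : i + 1 ≠ i' := Nat.ne_of_gt hin
      refine ⟨hin.le, ?_, ?_, ?_, ?_, ?_⟩
      · rw [Function.update_of_ne hne]; exact htop
      · intro j hij hjn
        rcases Nat.eq_or_lt_of_le hij with rfl | hlt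
        · rw [Function.update_self, ← hc]
          have h1 := hζ i' hjn _ hz
          rwa [Function.update_self] at h1
        · rw [Function.update_of_ne (Nat.ne_of_gt hlt)]
          exact hreg j hlt hjn
      · intro j hj b
        rw [Function.update_of_ne (Nat.ne_of_lt hj)]
        exact hlow j (Nat.lt_succ_of_lt hj) b
      · intro j hij hjn b hb
        rcases Nat.eq_or_lt_of_le hij with rfl | hlt
        · rw [Function.update_self, hagree b hb]
          exact hlow i' (Nat.lt_succ_self i') b
        · rw [Function.update_of_ne (Nat.ne_of_gt hlt)]
          exact hoff j hlt hjn b hb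
      · intro j hij hjn b hb
        rcases Nat.eq_or_lt_of_le hij with rfl | hlt
        · rw [Function.update_self, Function.update_of_ne (Nat.succ_ne_self i')]
          exact hfibre (fun b' _ => hlow i' (Nat.lt_succ_self i') b') b hb
        · rw [Function.update_of_ne (Nat.ne_of_gt hlt), Function.update_of_ne (Nat.ne_of_gt (Nat.lt_succ_of_lt hlt))]
          exact hfib j hlt hjn b hb
    · -- operands agree on `Good 0`
      rintro ω ⟨_, htop, hreg, _, hoff, hfib⟩
      exact hΦ S _ _ htop (fun j hj => hreg j (Nat.zero_le j) hj) (fun j hj => hoff j (Nat.zero_le j) hj) fun j hj => hfib j (Nat.zero_le j) hj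
    · funext b
      exact congrFun (baseCfg_top_fst (V := V) K (i + 1) Vn) b
    · exact ⟨le_rfl, baseCfg_top_fst K (i + 1) Vn, fun j hij hjn => absurd hjn (not_lt.mpr hij), fun j hj b => baseCfg_fst_of_ne K (Nat.ne_of_lt hj) Vn b,
        fun j hij hjn => absurd hjn (not_lt.mpr hij), fun j hij hjn => absurd hjn (not_lt.mpr hij)⟩

variable {𝔸 : Type*} [NormedRing 𝔸] [NormedAlgebra ℂ 𝔸] [CompleteSpace 𝔸]

/-- **★★★ THE §2 SLOT READS ITS OPERAND ONLY ON THE ITERATED FIBRE, FOR a.e. TOP-SCALE FIELD**: for `fieldMeasure`-a.e. `V_n`, ANY two term-value ∕ `E` ∕ background data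
whose operands `exp A_n(s)` agree at every `({S_i}, A, 𝐖)` with `𝐖 n = V_n`, `Reg j (𝐖 j)`, `𝐖 j ≡ 1` off `bondsIn j (Ω_{j+1})ᶜ` and `avg(𝐖_j) = 𝐖_{j+1}` on `bondsIn (j+1) (Ω_{j+1})ᶜ`
(`j < n`) give the same slot value at `V_n` — the form `hasSect2FormAtZS`'s a.e. identity clause consumes. [cite: Balaban1988Convergent, (2.17)–(2.18) p.257, (2.23) p.258, (2.20)–(2.21) p.258, (2.10) p.256] -/
theorem sect2Slot_congr_on_fibre_ae (Sg : Sect2.Setting 𝔸 (SU N)) (Rz : Sect2.Residual (F.P K) 𝔸) {n : ℕ} (s : SeqOfRecord F ν M g K n)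
    (Reg : (j : ℕ) → GaugeField (F.P K) j (SU N) → Prop)
    (hζ : ∀ j, j < n → ∀ ω : MultiCfg (F.P K) (SU N) V, W.ζ j (s.Ω (j + 1))ᶜ ω ≠ 0 → Reg j (ω j).1) :
    ∀ᵐ Vn ∂fieldMeasure (F.P K) n (SU N), ∀ (t t' : Sect2.TermValues (F.P K) 𝔸 V M) (Ek Ek' : ℝ) (U U' : BgMap F N K),
      (∀ (a : SFluct (F.P K) V) (Wc : MSField (F.P K) (SU N)), Wc n = Vn → (∀ j, j < n → Reg j (Wc j)) →
        (∀ j, j < n → ∀ b : PBond (F.P K) j, b ∉ bondsIn j (s.Ω (j + 1))ᶜ → Wc j b = 1) →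
        (∀ j, j < n → ∀ b : PBond (F.P K) (j + 1), b ∈ bondsIn (j + 1) (s.Ω (j + 1))ᶜ → (avOfRecord F N K j).avg (Wc j) b = Wc (j + 1) b) →
        sect2Operand F N V K Sg Rz s t Ek U a Wc = sect2Operand F N V K Sg Rz s t' Ek' U' a Wc) →
      sect2Slot F N V K Sg Rz W s t Ek U Vn = sect2Slot F N V K Sg Rz W s t' Ek' U' Vn := by
  filter_upwards [TkOfRecord_congr_on_fibre_ae ν M g K W s Reg hζ] with Vn hVn t t' Ek Ek' U U' hΦ
  exact hVn _ _ fun S a Wc h1 h2 h3 h4 => hΦ (S, a) Wc h1 h2 h3 h4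

end Record

/-! ## §2  At 12a″'s weights under the displayed law `RegOn`: the iterated fibre is regular on the reading regions -/

section RegOn

variable {F : T4Family} {N : ℕ} [NeZero N] {V : Type} [NormedAddCommGroup V] [InnerProductSpace ℝ V] [FiniteDimensional ℝ V] [MeasurableSpace V] [BorelSpace V]
variable {ν : Stage7Numerics} {A₁ cR : ℝ} {p : B12.RunParams} {g : ℕ → ℝ} (M : ℕ)

/-- **★★★ AT 12a″'s WEIGHTS UNDER `RegOn Γr`, `𝐓_n(s)` READS ITS OPERAND ONLY ON THE ITERATED FIBRE OF CONFIGURATIONS REGULAR ON THE READING REGIONS, a.e. IN `V_n`.**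
[cite: Balaban1988Convergent, (2.10) p.256, (2.18) p.257, (2.20)–(2.21) p.258, (1.11) p.248, (1.4) p.246] -/
theorem TkOfRecord_congr_on_fibre_ae_of_regOn {Γr : ℕ → Set (Site (F.P p.K) 0) → Set (Site (F.P p.K) 0)} {Z : TkResidualW F N V p.K}
    (hZ : Z.RegOn F N V ν cR p g Γr) {n : ℕ} (s : SeqOfRecord F ν M g p.K n) :
    ∀ᵐ Vn ∂fieldMeasure (F.P p.K) n (SU N), ∀ (Φ Φ' : SFluct (F.P p.K) V → MSField (F.P p.K) (SU N) → ℝ),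
      (∀ (S : ℕ → Set (Site (F.P p.K) 0)) (a : MSFluct (F.P p.K) V) (U : MSField (F.P p.K) (SU N)), U n = Vn →
        (∀ j, j < n → PlaqSmallOn (plaqsOf (pts j (Γr j (s.Ω (j + 1))ᶜ))) (cR * epsOfRecord ν g j) (U j)) →
        (∀ j, j < n → ∀ b : PBond (F.P p.K) j, b ∉ bondsIn j (s.Ω (j + 1))ᶜ → U j b = 1) →
        (∀ j, j < n → ∀ b : PBond (F.P p.K) (j + 1), b ∈ bondsIn (j + 1) (s.Ω (j + 1))ᶜ → (avOfRecord F N p.K j).avg (U j) b = U (j + 1) b) →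
        Φ (S, a) U = Φ' (S, a) U) →
      TkOfRecord F N V ν M g p.K (tkWeightsOfRecordP F N V ν A₁ p g Z) n s Φ Vn =
        TkOfRecord F N V ν M g p.K (tkWeightsOfRecordP F N V ν A₁ p g Z) n s Φ' Vn :=
  TkOfRecord_congr_on_fibre_ae ν M g p.K _ s (fun j U => PlaqSmallOn (plaqsOf (pts j (Γr j (s.Ω (j + 1))ᶜ))) (cR * epsOfRecord ν g j) U)
    fun j _ _ h => plaqSmallOn_readOn_of_zetaP_ne_zero hZ s.Ω j h

variable {𝔸 : Type*} [NormedRing 𝔸] [NormedAlgebra ℂ 𝔸] [CompleteSpace 𝔸]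

/-- **★★★ THE §2 SLOT AT 12a″'s WEIGHTS UNDER `RegOn Γr` READS ITS OPERAND ONLY ON THE ITERATED FIBRE OF CONFIGURATIONS REGULAR ON THE READING REGIONS, a.e. IN `V_n`.**
[cite: Balaban1988Convergent, (2.10) p.256, (2.18) p.257, (2.23) p.258, (2.20)–(2.21) p.258, (1.4) p.246] -/
theorem sect2Slot_congr_on_fibre_ae_of_regOn (Sg : Sect2.Setting 𝔸 (SU N)) (Rz : Sect2.Residual (F.P p.K) 𝔸)
    {Γr : ℕ → Set (Site (F.P p.K) 0) → Set (Site (F.P p.K) 0)} {Z : TkResidualW F N V p.K} (hZ : Z.RegOn F N V ν cR p g Γr) {n : ℕ}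
    (s : SeqOfRecord F ν M g p.K n) :
    ∀ᵐ Vn ∂fieldMeasure (F.P p.K) n (SU N), ∀ (t t' : Sect2.TermValues (F.P p.K) 𝔸 V M) (Ek Ek' : ℝ) (U U' : BgMap F N p.K),
      (∀ (a : SFluct (F.P p.K) V) (Wc : MSField (F.P p.K) (SU N)), Wc n = Vn →
        (∀ j, j < n → PlaqSmallOn (plaqsOf (pts j (Γr j (s.Ω (j + 1))ᶜ))) (cR * epsOfRecord ν g j) (Wc j)) →
        (∀ j, j < n → ∀ b : PBond (F.P p.K) j, b ∉ bondsIn j (s.Ω (j + 1))ᶜ → Wc j b = 1) →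
        (∀ j, j < n → ∀ b : PBond (F.P p.K) (j + 1), b ∈ bondsIn (j + 1) (s.Ω (j + 1))ᶜ → (avOfRecord F N p.K j).avg (Wc j) b = Wc (j + 1) b) →
        sect2Operand F N V p.K Sg Rz s t Ek U a Wc = sect2Operand F N V p.K Sg Rz s t' Ek' U' a Wc) →
      sect2Slot F N V p.K Sg Rz (tkWeightsOfRecordP F N V ν A₁ p g Z) s t Ek U Vn =
        sect2Slot F N V p.K Sg Rz (tkWeightsOfRecordP F N V ν A₁ p g Z) s t' Ek' U' Vn :=
  sect2Slot_congr_on_fibre_ae ν M g p.K _ Sg Rz s (fun j U => PlaqSmallOn (plaqsOf (pts j (Γr j (s.Ω (j + 1))ᶜ))) (cR * epsOfRecord ν g j) U)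
    fun j _ _ h => plaqSmallOn_readOn_of_zetaP_ne_zero hZ s.Ω j h

end RegOn

end Summit.QuantumFields.YangMills.Theorems.BalabanUVNodesN11TkIteratedFibreReadingSlot

end
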